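import Summits.BirchSwinnertonDyer.BirchSwinnertonDyer.Theorems.PublishedInputsGreenbergLocalSurjectivityAtPHTwo
import HarnessLib

set_option linter.dupNamespace false -- `…BirchSwinnertonDyer.BirchSwinnertonDyer…` is the cell's nested layout (D-0017)
set_option autoImplicit false

/-!
# Route `ByReductionTypeAtTwo`, crux `MultUpperHalfAtTwo` (item stmt-BirchSwinnertonDyer-19922), TOWER road, Greenberg LNM 1716
# §4 p. 108 «for `v ∣ p`» at a MULTIPLICATIVE place, part 3 — `H²(K_v, C) = 0` for a `p`-divisible `p`-primary `C ≤ E(K̄_v)`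
# with CYCLIC layers `C[p^k]` on which some `τ` fixing `μ_{p^∞}` acts as `−1` (the Tate torsion `Ψ(μ_{p^∞}) ≅ μ_{p^∞}(χ)`)

HONEST FRAMING (cell `bsd-2adic`, run/shared/lean/pub/bsd-2adic/, seat `bsd-2adic-tower-1` GEN 29, HUMAN RULINGS
D-0036 / D-0054 / D-0074): TOOL theorems only (no definition, no named fact, no `sorry`); closes nothing by itself;
nothing booked; BSD is not proved by any of this.

bsd-inputs-k4-p1's `InputsGreenbergLocalAtP.subsingleton_continuousCohomology_two_formalTorsion`
(`PublishedInputsGreenbergLocalSurjectivityAtPHTwo`) proves `H²(K_v, Ê[p^∞]) = 0` at a good ORDINARY place from Tate local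
duality in bidegree `(2,0)` (`natCard_two_eq_natCard_invariants_homRep`: `#H²(K_v, Z) = #Hom_Γ(Z, μ_{p^k})`), the count of
equivariant maps out of a cyclic module (`GoodOrdTower.natCard_equivariant_le_card_filter`) bounded through a Frobenius, and
`subsingleton_two_of_divisible_of_natCard_le` (`cd_p Γ_{K_v} ≤ 2`, `C` `p`-divisible, bounded finite layers). At a NON-SPLIT
MULTIPLICATIVE place the relevant torsion is `C = Ψ(μ_{p^∞}) ≅ μ_{p^∞} ⊗ χ` (`Ψ` Tate's twisted uniformisation, `χ` the
quadratic character of `K_v(√γ)/K_v`), and the bound is even simpler: an element `τ ∈ Γ_{K_v}` fixing `μ_{p^∞}` with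
`χ(τ) = −1` acts as `−1` on `C`, so an equivariant `f : C[p^k] → μ_{p^k}` has `2 f = 0`, whence `#Hom_Γ(C[p^k], μ_{p^k}) ≤ 2`.

* `subsingleton_continuousCohomology_two_of_neg` — for a number field `K`, a finite place `v`, a Weierstrass curve `W/K`,
  a subgroup `C ≤ E(K̄_v)` that is `p`-primary (`hprim`), `p`-divisible (`hdiv`), with CYCLIC layers (`hgen`: `C[p^r]` is
  generated by an element of order `p^r`, every `r`), an element `τ ∈ Γ_{K_v}` fixing every `p`-power root of unity
  (`hτfix`) and acting as `−1` on `C` (`hτneg`), and ANY continuous representation `ρ` of `Γ_{K_v}` on `C` acting as the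
  Galois action: **`H²(Γ_{K_v}, C) = 0`** (`#H²(K_v, C[p^k]) ≤ #{i < p^k : p^k ∣ 2i} ≤ 2` for all `k`).

References: [GreenbergLNM1716] §2 pp. 75–76, §4 p. 108; [MilneADT2006] I Cor. 2.3, I §3; [SerreGaloisCohomology1997]
II §4.3 Prop. 12, II §5.2 Thm. 2; [SilvermanATAEC1994] V.5.2–V.5.3 (the twisted uniformisation that produces such `C`).
-/

noncomputable section

open scoped Classical NNReal

universe u

namespace Summit.BirchSwinnertonDyer.BirchSwinnertonDyer.Theorems.MultLocSurj

open CategoryTheory NumberField IsDedekindDomain Field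
  Literature.NumberTheory.GaloisRepresentations Literature.NumberTheory.GaloisRepresentations.DiscreteGaloisModule
  IsDedekindDomain.HeightOneSpectrum _root_.TopRep _root_.ContRepresentation _root_.ContinuousCohomology WeierstrassCurve
  Summit.BirchSwinnertonDyer.BirchSwinnertonDyer.Theorems.GoodOrdTower
open Literature.NumberTheory.EllipticCurves hiding subgroupIncl

variable {K : Type u} [Field K] [NumberField K] (v : HeightOneSpectrum (𝓞 K)) (W : WeierstrassCurve K)
  {p : ℕ} [hp : Fact p.Prime]

/-- The indices `i < q` with `q ∣ 2 i` are among `0` and `q / 2`; there are at most two. [folklore] -/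
theorem card_filter_dvd_two_mul_le_two (q : ℕ) :
    ((Finset.range q).filter fun i : ℕ ↦ q ∣ 2 * i).card ≤ 2 := by
  refine le_trans (Finset.card_le_card (t := {0, q / 2}) fun i hi ↦ ?_) (Finset.card_le_two)
  rw [Finset.mem_filter, Finset.mem_range] at hi
  obtain ⟨hi, ⟨c, hc⟩⟩ := hi
  rw [Finset.mem_insert, Finset.mem_singleton]
  have hc2 : c < 2 := by
    by_contra h
    push Not at h
    have : q * 2 ≤ q * c := Nat.mul_le_mul_left q h
    omega
  interval_cases c
  · left; omega
  · right; omega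

set_option maxHeartbeats 3200000 in
/-- **`H²(K_v, C) = 0` for a `p`-divisible `p`-primary `C ≤ E(K̄_v)` with cyclic layers on which some `τ` fixing `μ_{p^∞}`
acts as `−1`** — the case `C = Ψ(μ_{p^∞}) ≅ μ_{p^∞}(χ)` of Tate's twisted uniformisation at a NON-SPLIT multiplicative place
(Greenberg LNM 1716 §2 pp. 75–76 / p. 108 «the maps `λ_v` for `v ∣ p`»; Milne ADT I §3). Setting: `K` a number field, `v` a
finite place, `W/K` a Weierstrass curve, `C ≤ E(K̄_v)` `p`-primary (`hprim`) and `p`-divisible (`hdiv`) with `C[p^r]` cyclic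
on an element of order `p^r` for every `r` (`hgen`), `τ ∈ Γ_{K_v}` fixing the `p`-power roots of unity (`hτfix`) with
`τ•P = −P` on `C` (`hτneg`), `ρ` ANY continuous representation of `Γ_{K_v}` on `C` acting as the Galois action (`hρ`). Then
`continuousCohomology 2 ρ.toTopRep` is a singleton: by local duality `(2,0)` and the count of equivariant maps out of the
cyclic `C[p^k]`, `#H²(K_v, C[p^k]) ≤ #{i < p^k : τ(iP_k) = iP_k} = #{i < p^k : p^k ∣ 2i} ≤ 2`, and
`subsingleton_two_of_divisible_of_natCard_le` (`cd_p Γ_{K_v} ≤ 2`). k4-p1's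
`subsingleton_continuousCohomology_two_formalTorsion` with the ordinary filtration replaced by the flip `τ` (adapted proof).
[cite: GreenbergLNM1716, §2 pp. 75–76 and §4 p. 108] [cite: MilneADT2006, I Cor. 2.3 and §3]
[cite: SerreGaloisCohomology1997, II §4.3 Prop. 12] -/
theorem subsingleton_continuousCohomology_two_of_neg
    (C : AddSubgroup (localPoints W (v.adicCompletion K)))
    (hprim : ∀ a ∈ C, ∃ e : ℕ, p ^ e • a = 0)
    (hdiv : ∀ a ∈ C, ∃ b ∈ C, p • b = a)
    (hgen : ∀ r : ℕ, ∃ P₁ ∈ C, addOrderOf P₁ = p ^ r ∧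
      ∀ P ∈ C, p ^ r • P = 0 → ∃ c : ℕ, P = c • P₁)
    {τ : absoluteGaloisGroup (v.adicCompletion K)}
    (hτfix : ∀ (r : ℕ) (ξ : AlgebraicClosure (v.adicCompletion K)), ξ ^ p ^ r = 1 → τ • ξ = ξ)
    (hτneg : ∀ P ∈ C, τ • P = -P)
    (ρ : ContinuousRep (absoluteGaloisGroup (v.adicCompletion K)) ℤ C)
    (hρ : ∀ (σ : absoluteGaloisGroup (v.adicCompletion K)) (c : C),
      ((ρ σ c : C) : localPoints W (v.adicCompletion K)) = σ • (c : localPoints W (v.adicCompletion K))) :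
    Subsingleton (continuousCohomology 2 ρ.toTopRep) := by
  -- adapted from `InputsGreenbergLocalAtP.subsingleton_continuousCohomology_two_formalTorsion` (bsd-inputs-k4-p1)
  -- notation
  let E := v.adicCompletion K
  let P : Type u := localPoints W E
  let Γ := absoluteGaloisGroup E
  haveI : CompactSpace Γ := absoluteGaloisGroup_compactSpace E
  haveI : T2Space Γ := krullTopology_t2
  have galois_smul_nsmul : ∀ (σ : Γ) (n : ℕ) (Q : P), σ • (n • Q) = n • (σ • Q) :=
    fun σ n Q ↦ map_nsmul (DistribSMul.toAddMonoidHom P σ) n Q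
  -- `C` is `p`-primary and `p`-divisible
  have hprim' : IsPrimaryTorsion p C := fun a ↦ by
    obtain ⟨e, he⟩ := hprim a a.2
    exact ⟨e, Subtype.ext (by rw [AddSubgroupClass.coe_nsmul, he, ZeroMemClass.coe_zero])⟩
  have hdiv' : ∀ a : C, ∃ b : C, p • b = a := fun a ↦ by
    obtain ⟨b, hb, hba⟩ := hdiv a a.2
    exact ⟨⟨b, hb⟩, Subtype.ext (by rw [AddSubgroupClass.coe_nsmul]; exact hba)⟩
  -- the bound `#H²(K_v, C[p^k]) ≤ 2` at every depth
  have hk : ∀ k : ℕ, Finite (continuousCohomology 2 (ρ.torsionRep (p ^ k)).toTopRep) ∧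
      Nat.card (continuousCohomology 2 (ρ.torsionRep (p ^ k)).toTopRep) ≤ 2 := by
    intro k
    -- the generator `P_k` of `C[p^k]`
    obtain ⟨Pk, hPkC, hPkord, hPkgen⟩ := hgen k
    have hPk2 : p ^ k • Pk = 0 := by rw [← hPkord]; exact addOrderOf_nsmul_eq_zero Pk
    haveI : CharZero E := charZero_of_injective_algebraMap (algebraMap K E).injective
    -- the torsion module `Z = C[p^k]` and the embedding `ι : Z → E(K̄_v)`
    let Z : Type u := Submodule.torsionBy ℤ C ((p ^ k : ℕ) : ℤ)
    let ι : Z →+ P := C.subtype.comp (Submodule.torsionBy ℤ C ((p ^ k : ℕ) : ℤ)).subtype.toAddMonoidHom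
    have hι : ∀ z : Z, ι z = ((z : C) : P) := fun _ ↦ rfl
    have hιinj : Function.Injective ι := fun a b hab ↦ Subtype.ext (Subtype.ext hab)
    have hZmem : ∀ z : Z, ι z ∈ C ∧ p ^ k • ι z = 0 := fun z ↦ by
      refine ⟨(z : C).2, ?_⟩
      have h := (ContinuousRep.mem_torsionBy_nsmul_iff (p ^ k)).1 z.2
      have h' := congrArg (fun x : C ↦ (x : P)) h
      simp only [AddSubgroupClass.coe_nsmul, ZeroMemClass.coe_zero] at h'
      rw [hι]; exact h'
    let Pz : Z := ⟨⟨Pk, hPkC⟩, (ContinuousRep.mem_torsionBy_nsmul_iff (p ^ k)).2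
      (Subtype.ext (by rw [AddSubgroupClass.coe_nsmul, ZeroMemClass.coe_zero]; exact hPk2))⟩
    have hιPz : ι Pz = Pk := rfl
    have hZgen : ∀ z : Z, ∃ i : ℕ, z = i • Pz := fun z ↦ by
      obtain ⟨c, hc⟩ := hPkgen (ι z) (hZmem z).1 (hZmem z).2
      exact ⟨c, hιinj (by rw [map_nsmul, hιPz]; exact hc)⟩
    have hPzord : addOrderOf Pz = p ^ k := by
      rw [← addOrderOf_injective ι hιinj Pz, hιPz]; exact hPkord
    -- `Z` is finite (cyclic on `Pz`)
    haveI hZfin : Finite Z := by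
      haveI : Finite (AddSubgroup.zmultiples Pk) := Nat.finite_of_card_ne_zero (by
        rw [Nat.card_zmultiples, hPkord]; exact pow_ne_zero k hp.out.ne_zero)
      refine Finite.of_injective (fun z : Z ↦ (⟨ι z, ?_⟩ : AddSubgroup.zmultiples Pk)) fun a b hab ↦ ?_
      · obtain ⟨i, rfl⟩ := hZgen z
        rw [map_nsmul, hιPz]
        exact AddSubgroup.nsmul_mem _ (AddSubgroup.mem_zmultiples Pk) i
      · exact hιinj (congrArg (fun y : AddSubgroup.zmultiples Pk ↦ (y : P)) hab)
    have hZk : ∀ z : Z, p ^ k • z = 0 := fun z ↦ hιinj (by rw [map_nsmul, map_zero]; exact (hZmem z).2)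
    -- the action on `Z`: `ι (ρ_k σ z) = σ • ι z`; `τ P_k = (p^k - 1) P_k`
    have hρk : ∀ (σ : Γ) (z : Z), ι ((ρ.torsionRep (p ^ k)) σ z) = σ • ι z := fun σ z ↦ by
      rw [hι, hι, ContinuousRep.subrepresentation_apply_coe, hρ]
    have hb : τ • Pk = (p ^ k - 1) • Pk := by
      rw [hτneg Pk hPkC, eq_comm, ← sub_eq_zero, sub_neg_eq_add, ← succ_nsmul,
        Nat.sub_add_cancel (Nat.one_le_pow k p hp.out.pos), hPk2]
    have hb' : (ρ.torsionRep (p ^ k)) τ Pz = (p ^ k - 1) • Pz := hιinj (by rw [hρk, map_nsmul, hιPz]; exact hb)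
    -- `τ` acts trivially on `μ_{p^k}`
    have hτω : ∀ z : MuCarrier E (p ^ k), mu E (p ^ k) τ z = z := by
      intro z
      have hu1 : (((MuCarrier.toAdditive z).toMul : (AlgebraicClosure E)ˣ) : AlgebraicClosure E) ^ p ^ k = 1 := by
        have h' := ((MuCarrier.toAdditive z).toMul).2
        rw [mem_rootsOfUnity] at h'
        rw [← Units.val_pow_eq_pow_val, h', Units.val_one]
      apply MuCarrier.toAdditive.injective
      rw [mu_apply_apply]
      refine congrArg Additive.ofMul (Subtype.ext (Units.ext ?_))
      rw [absoluteGaloisGroup.coe_smul_rootsOfUnity, Units.coe_smul]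
      exact hτfix k _ hu1
    haveI : NeZero (p ^ k) := ⟨pow_ne_zero k hp.out.ne_zero⟩
    -- local duality `(2,0)`: `#H²(K_v, Z) = #Hom_Γ(Z, μ_{p^k})`
    obtain ⟨hfin2, hcard2⟩ := natCard_two_eq_natCard_invariants_homRep E (ρ.torsionRep (p ^ k)) hZk
    refine ⟨hfin2, ?_⟩
    rw [hcard2]
    -- invariants of `Hom(Z, μ)` are the equivariant maps
    haveI : Finite {f : Z →+ MuCarrier E (p ^ k) // ∀ (h : (⊤ : Subgroup Γ)) (m : Z),
        f ((ρ.torsionRep (p ^ k)) (h : Γ) m) = mu E (p ^ k) (h : Γ) (f m)} := by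
      haveI : Finite (MuCarrier E (p ^ k)) := Finite.of_equiv _ (muEquivZMod E (p ^ k)).toEquiv.symm
      haveI : Finite (Z →+ MuCarrier E (p ^ k)) := Finite.of_injective (fun f : Z →+ MuCarrier E (p ^ k) ↦ (f : Z → _))
        (fun f g h ↦ AddMonoidHom.ext fun m ↦ congrFun h m)
      exact Finite.of_injective _ Subtype.val_injective
    let Ψ : ((ρ.torsionRep (p ^ k)).homRep (mu E (p ^ k))).toTopRep.ρ.invariants →
        {f : Z →+ MuCarrier E (p ^ k) // ∀ (h : (⊤ : Subgroup Γ)) (m : Z),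
          f ((ρ.torsionRep (p ^ k)) (h : Γ) m) = mu E (p ^ k) (h : Γ) (f m)} :=
      fun Φ ↦ ⟨((Φ : HomCarrier Z (MuCarrier E (p ^ k))) : Z →+ MuCarrier E (p ^ k)), fun h m ↦
        (((ContinuousRep.homRep_apply_eq_self_iff (ρ.torsionRep (p ^ k)) (mu E (p ^ k)) (h : Γ)
          (Φ : HomCarrier Z (MuCarrier E (p ^ k)))).mp (Φ.2 (h : Γ))) m).symm⟩
    have hΨ : Function.Injective Ψ := fun Φ Φ' hΦ ↦
      Subtype.ext (HomCarrier.ext fun m ↦ congrArg (fun f : {f : Z →+ MuCarrier E (p ^ k) //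
        ∀ (h : (⊤ : Subgroup Γ)) (m : Z), f ((ρ.torsionRep (p ^ k)) (h : Γ) m) = mu E (p ^ k) (h : Γ) (f m)} ↦ f.1 m) hΦ)
    refine (Nat.card_le_card_of_injective Ψ hΨ).trans ?_
    -- equivariant maps out of the cyclic `Z`, then the count `#{i < p^k : p^k ∣ 2i} ≤ 2`
    have hD2 := natCard_equivariant_le_card_filter (⊤ : Subgroup Γ) (ρ.torsionRep (p ^ k)) (mu E (p ^ k))
      (muEquivZMod E (p ^ k)) hPzord hZgen (Subgroup.mem_top τ) hτω hb'
    refine hD2.trans (le_trans (Finset.card_le_card fun i hi ↦ ?_) (card_filter_dvd_two_mul_le_two (p ^ k)))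
    simp only [Finset.mem_filter] at hi ⊢
    refine ⟨hi.1, ?_⟩
    -- `τ (i P_k) = i P_k` forces `2 i P_k = 0`
    have h := congrArg ι hi.2
    rw [hρk, map_nsmul, hιPz, galois_smul_nsmul, hτneg Pk hPkC, smul_neg, neg_eq_iff_add_eq_zero, ← two_nsmul,
      ← mul_nsmul, mul_comm] at h
    rw [← hPkord]
    exact addOrderOf_dvd_of_nsmul_eq_zero h
  haveI : CharZero E := charZero_of_injective_algebraMap (algebraMap K E).injective
  exact subsingleton_two_of_divisible_of_natCard_le ρ (groupCdLE_two_absoluteGaloisGroup E p) hprim' hdiv' 2 hk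

end Summit.BirchSwinnertonDyer.BirchSwinnertonDyer.Theorems.MultLocSurj

end
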